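import Summits.CriticalPhenomena.PercolationContinuityZ3.Theorems.Transplant.BoxProdZ2ConcExcess
import Summits.CriticalPhenomena.PercolationContinuityZ3.Theorems.Transplant.BoxProdZ2ConcRootHop
import HarnessLib

/-!
# The ROUTE LAW of an elongated inner route of the face step (design (D), §11 v2; residue (F), `advRoute_of_contact` part 4a): the face law
# `Wt` with the kit prism `S` wired (its `X □ ℤ²`-edges pinned open) and cut to the route world `Qt` — `routeW Wt Qt S` — is a subbox weighting
# of the INNER tube graph over `B_X(c, L_A)` on every fresh region inside `Qt`; its point-source connection from the prism centre is dominated by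
# the link event from `S` under `Wt`; and the first hop from the wired prism (p3-g2's `wired_prism_hsrc` with the pointwise seed bound)

builds on p205010 (kernel theorem, internal audit signed; external expert review pending) — nothing in this file uses p205010.
Lane `prim-bschramm`, seat `prim-bschramm-p3` (residue (F) of V56, arbitration 16:02Z); helper file (`--supports stmt-CriticalPhenomena-4575`).

* `isSubbox_restrW_subtube` — a subbox of `W` in the tube graph over `π` stays a subbox of `restrW Qt W` in the tube graph over a smaller
  window `π' ⊆ π` containing the fibres of `Qt` (`W` vanishing off the edges of `X □ ℤ²`);
* `routeW Wt Qt S := restrW Qt (pinW Wt (edgesIn S) (edgesIn S))`; `routeW_eq_one` (on the edges of `S`), `routeW_ge` (on the edges of a subbox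
  region), `routeW_eq_zero_of_not_mem_edgeSet`, **`isSubbox_routeW`**, `finSupp_routeW`;
* **`real_biUnion_openConn_routeW_le_linkIn`** — `P_{routeW}(⋃_{t ∈ Ft} o ↔ t) ≤ P_{Wt}(linkIn Qt S Ft)` (`o ∈ S ⊆ Qt`, `S ∩ Ft = ∅`);
* **`wired_prism_hsrc_of_le`** — the first hop from the wired prism, with the seed bound `msel (γ c) ≤ ℓ` only at the contact's representative.
[cite: KozmaNitzan2024, §4 Lemma 10 (p. 17: subbox), Lemma 11 (p. 22: the wired cube, Ω), p. 30 (Step III)]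
-/

noncomputable section

open MeasureTheory

namespace Summit.CriticalPhenomena.PercolationContinuityZ3.Theorems

namespace Transplant

namespace BoxProdZ2

open Literature.Probability.Percolation Literature.Probability.LatticeModels SimpleGraph KNLevels
open Literature.Barriers.CriticalPhenomena (graphBall graphBall_finite mem_graphBall_self graphBall_mono)

variable {W : Type} [DecidableEq W] (X : SimpleGraph W) [X.LocallyFinite]

/-! ## §1 Subboxes under restriction to a smaller tube -/

/-- **Restriction to a route world inside a smaller tube keeps subboxes.**  If `W` vanishes off the edges of `X □ ℤ²` and `Dd` is a subbox of
`W` in the tube graph over `π`, then for `Dd ⊆ Qt` with all fibres of `Qt` in `π' ⊆ π`, `Dd` is a subbox of `restrW Qt W` in the tube graph over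
`π'` (exterior attachments through fibres outside `π'` are cut by the restriction). [cite: KozmaNitzan2024, §4 p. 17 (subbox), p. 22 (Ω)] -/
theorem isSubbox_restrW_subtube {π π' : Finset W} (hπ : π' ⊆ π) {Wt : Sym2 (W × Site 2) → unitInterval} {p : unitInterval}
    (hWG : ∀ e, e ∉ (X □ zdGraph 2).edgeSet → Wt e = 0) {Qt Dd : Finset (W × Site 2)} (hDQ : Dd ⊆ Qt) (hQπ : ∀ u ∈ Qt, u.1 ∈ π')
    (hW : IsSubbox (tubeGraph X π) Wt p Dd) : IsSubbox (tubeGraph X π') (restrW (↑Qt : Set (W × Site 2)) Wt) p Dd := by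
  refine ⟨fun u hu v hv huv => ?_, fun u hu v hv hne huv => ?_, fun v hv hvb x hx => ?_⟩
  · rw [restrW_apply_of_mem _ (mk_mem_wireSet_iff.2 ⟨Finset.mem_coe.2 (hDQ hu), Finset.mem_coe.2 (hDQ hv), huv.ne⟩)]
    obtain ⟨hadj, hu1, hv1⟩ := (tubeGraph_adj X).1 huv
    exact hW.adj u hu v hv ((tubeGraph_adj X).2 ⟨hadj, hπ hu1, hπ hv1⟩)
  · rw [restrW_apply_of_mem _ (mk_mem_wireSet_iff.2 ⟨Finset.mem_coe.2 (hDQ hu), Finset.mem_coe.2 (hDQ hv), hne⟩)]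
    refine hW.nadj u hu v hv hne fun h' => huv ?_
    exact (tubeGraph_adj X).2 ⟨((tubeGraph_adj X).1 h').1, hQπ u (hDQ hu), hQπ v (hDQ hv)⟩
  · by_cases hxQ : s(x, v) ∈ wireSet (↑Qt : Set (W × Site 2))
    · rw [restrW_apply_of_mem _ hxQ]
      obtain ⟨hxQ', -, hne⟩ := mk_mem_wireSet_iff.1 hxQ
      -- `x` and `v` are not adjacent: an `X □ ℤ²`-edge between them would be a `π'`-tube edge into the interior vertex `v`
      refine hWG _ fun hedge => hvb ?_
      rw [SimpleGraph.mem_edgeSet] at hedge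
      exact mem_innerBoundary_iff.2 ⟨hv, x, hx, (tubeGraph_adj X).2 ⟨hedge.symm, hQπ v (hDQ hv), hQπ x (Finset.mem_coe.1 hxQ')⟩⟩
    · exact restrW_apply_of_not_mem _ hxQ

/-! ## §2 The route law -/

/-- **The route law**: the face law `Wt` with the `X □ ℤ²`-edges inside the kit prism `S` pinned open, cut to the route world `Qt`.
[cite: KozmaNitzan2024, §4 Lemma 11 (p. 22: the cube wired to a point, the graph Ω)] -/
def routeW (Wt : Sym2 (W × Site 2) → unitInterval) (Qt S : Finset (W × Site 2)) : Sym2 (W × Site 2) → unitInterval :=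
  restrW (↑Qt : Set (W × Site 2)) (pinW Wt (↑(edgesIn (X □ zdGraph 2) S) : Set (Sym2 (W × Site 2))) ↑(edgesIn (X □ zdGraph 2) S))

/-- The pinned edges of `S` are pairs inside `S`. [folklore] -/
theorem coe_edgesIn_subset_wireSet (S : Finset (W × Site 2)) :
    (↑(edgesIn (X □ zdGraph 2) S) : Set (Sym2 (W × Site 2))) ⊆ wireSet (↑S : Set (W × Site 2)) := by
  intro e he
  obtain ⟨hedge, hends⟩ := mem_edgesIn_iff.1 (Finset.mem_coe.1 he)
  induction e using Sym2.ind with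
  | h x y =>
    exact mk_mem_wireSet_iff.2 ⟨Finset.mem_coe.2 (hends x (Sym2.mem_mk_left x y)), Finset.mem_coe.2 (hends y (Sym2.mem_mk_right x y)),
      ((SimpleGraph.mem_edgeSet _).1 hedge).ne⟩

/-- **The route law gives weight `1` to the edges inside `S`** (`S ⊆ Qt`). [folklore] -/
theorem routeW_eq_one {Wt : Sym2 (W × Site 2) → unitInterval} {Qt S : Finset (W × Site 2)} (hSQ : S ⊆ Qt) {u u' : W × Site 2}
    (hu : u ∈ S) (hu' : u' ∈ S) (hadj : (X □ zdGraph 2).Adj u u') : routeW X Wt Qt S s(u, u') = 1 := by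
  have hF : s(u, u') ∈ (↑(edgesIn (X □ zdGraph 2) S) : Set (Sym2 (W × Site 2))) :=
    Finset.mem_coe.2 (mem_edgesIn_iff.2 ⟨(SimpleGraph.mem_edgeSet _).2 hadj, fun z hz => by
      rcases Sym2.mem_iff.1 hz with rfl | rfl
      exacts [hu, hu']⟩)
  unfold routeW
  rw [restrW_apply_of_mem _ (mk_mem_wireSet_iff.2 ⟨Finset.mem_coe.2 (hSQ hu), Finset.mem_coe.2 (hSQ hu'), hadj.ne⟩),
    pinW_apply_of_mem_of_mem _ hF hF]

/-- **The route law gives weight `≥ q` to the edges of a subbox region `D` of `Wt` inside `Qt`** (in the tube graph over `π`).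
[folklore] -/
theorem routeW_ge {π : Finset W} {Wt : Sym2 (W × Site 2) → unitInterval} {q : unitInterval} {D : Finset (W × Site 2)}
    (hWD : IsSubbox (tubeGraph X π) Wt q D) (hDπ : ∀ u ∈ D, u.1 ∈ π) {Qt S F : Finset (W × Site 2)} (hFQ : F ⊆ Qt) (hFD : F ⊆ D)
    {u u' : W × Site 2} (hu : u ∈ F) (hu' : u' ∈ F) (hadj : (X □ zdGraph 2).Adj u u') : q ≤ routeW X Wt Qt S s(u, u') := by
  unfold routeW
  rw [restrW_apply_of_mem _ (mk_mem_wireSet_iff.2 ⟨Finset.mem_coe.2 (hFQ hu), Finset.mem_coe.2 (hFQ hu'), hadj.ne⟩)]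
  by_cases hF : s(u, u') ∈ (↑(edgesIn (X □ zdGraph 2) S) : Set (Sym2 (W × Site 2)))
  · rw [pinW_apply_of_mem_of_mem _ hF hF]; exact unitInterval.le_one _
  · rw [pinW_apply_of_not_mem _ _ hF, hWD.adj u (hFD hu) u' (hFD hu') ((tubeGraph_adj X).2 ⟨hadj, hDπ u (hFD hu), hDπ u' (hFD hu')⟩)]

/-- **The route law vanishes off the edges of `X □ ℤ²`** when `Wt` does. [folklore] -/
theorem routeW_eq_zero_of_not_mem_edgeSet {Wt : Sym2 (W × Site 2) → unitInterval} (hWG : ∀ e, e ∉ (X □ zdGraph 2).edgeSet → Wt e = 0)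
    (Qt S : Finset (W × Site 2)) {e : Sym2 (W × Site 2)} (he : e ∉ (X □ zdGraph 2).edgeSet) : routeW X Wt Qt S e = 0 := by
  have hF : e ∉ (↑(edgesIn (X □ zdGraph 2) S) : Set (Sym2 (W × Site 2))) := fun h' =>
    he (mem_edgesIn_iff.1 (Finset.mem_coe.1 h')).1
  have hle := restrW_le (↑Qt : Set (W × Site 2)) (pinW Wt (↑(edgesIn (X □ zdGraph 2) S) : Set (Sym2 (W × Site 2)))
    ↑(edgesIn (X □ zdGraph 2) S)) e
  rw [pinW_apply_of_not_mem _ _ hF, hWG e he] at hle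
  exact le_antisymm hle bot_le

/-- The pinned face law vanishes off the edges of `X □ ℤ²` when `Wt` does. [folklore] -/
theorem pinW_edgesIn_eq_zero_of_not_mem_edgeSet {Wt : Sym2 (W × Site 2) → unitInterval}
    (hWG : ∀ e, e ∉ (X □ zdGraph 2).edgeSet → Wt e = 0) (S : Finset (W × Site 2)) {e : Sym2 (W × Site 2)}
    (he : e ∉ (X □ zdGraph 2).edgeSet) :
    pinW Wt (↑(edgesIn (X □ zdGraph 2) S) : Set (Sym2 (W × Site 2))) ↑(edgesIn (X □ zdGraph 2) S) e = 0 := by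
  have hF : e ∉ (↑(edgesIn (X □ zdGraph 2) S) : Set (Sym2 (W × Site 2))) := fun h' =>
    he (mem_edgesIn_iff.1 (Finset.mem_coe.1 h')).1
  rw [pinW_apply_of_not_mem _ _ hF, hWG e he]

/-- **The route law is a subbox weighting of the inner tube graph on every fresh region**: if `Dd` is a subbox of `Wt` in the tube graph
over `π`, `Dd ⊆ Qt` with the fibres of `Qt` in `π' ⊆ π`, and `Dd` misses the wired prism `S`, then `Dd` is a subbox of `routeW Wt Qt S` in the
tube graph over `π'`. [cite: KozmaNitzan2024, §4 p. 17 (subbox), Lemma 11 (p. 22: Ω minus the wired cube)] -/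
theorem isSubbox_routeW {π π' : Finset W} (hπ : π' ⊆ π) {Wt : Sym2 (W × Site 2) → unitInterval} {q : unitInterval}
    (hWG : ∀ e, e ∉ (X □ zdGraph 2).edgeSet → Wt e = 0) {Qt S Dd : Finset (W × Site 2)} (hDQ : Dd ⊆ Qt) (hQπ : ∀ u ∈ Qt, u.1 ∈ π')
    (hSD : Disjoint S Dd) (hW : IsSubbox (tubeGraph X π) Wt q Dd) : IsSubbox (tubeGraph X π') (routeW X Wt Qt S) q Dd :=
  isSubbox_restrW_subtube X hπ (fun _ he => pinW_edgesIn_eq_zero_of_not_mem_edgeSet X hWG S he) hDQ hQπ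
    (hW.pinW_of_disjoint hSD (coe_edgesIn_subset_wireSet X S) _)

omit [X.LocallyFinite] in
/-- The route law is supported on the route world. [folklore] -/
theorem finSupp_routeW [X.LocallyFinite] (Wt : Sym2 (W × Site 2) → unitInterval) (Qt S : Finset (W × Site 2)) :
    FinSupp (routeW X Wt Qt S) Qt :=
  finSupp_restrW Qt _

/-! ## §3 Domination: the point-source connection under the route law versus the link event under `Wt` -/

/-- **`P_{routeW}(⋃_{t ∈ Ft} o ↔ t) ≤ P_{Wt}(linkIn Qt S Ft)`** for `o ∈ S ⊆ Qt`, `S ∩ Ft = ∅`: under the cut law open paths stay in `Qt`,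
a connection from `o ∈ S` inside `Qt` is a link from `S`, and wiring `S` does not change the link probability.
[cite: KozmaNitzan2024, §4 Lemma 11 (p. 22), p. 24 (P(o ↔^A ·))] -/
theorem real_biUnion_openConn_routeW_le_linkIn [Countable W] (Wt : Sym2 (W × Site 2) → unitInterval) {Qt S Ft : Finset (W × Site 2)}
    (hSQ : S ⊆ Qt) (hSF : Disjoint S Ft) {o : W × Site 2} (ho : o ∈ S) :
    (prodBernoulli (routeW X Wt Qt S)).real (⋃ t ∈ Ft, openConn o t) ≤
      (prodBernoulli Wt).real (linkIn (↑Qt : Set (W × Site 2)) S Ft) := by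
  have h1 : (prodBernoulli (routeW X Wt Qt S)).real (⋃ t ∈ Ft, openConn o t) =
      (prodBernoulli (pinW Wt (↑(edgesIn (X □ zdGraph 2) S) : Set (Sym2 (W × Site 2))) ↑(edgesIn (X □ zdGraph 2) S))).real (⋃ t ∈ (↑Ft : Set (W × Site 2)), openConnIn (↑Qt : Set (W × Site 2)) o t) := by
    unfold routeW
    rw [← prodBernoulli_restrW_real_biUnion_openConn (pinW Wt (↑(edgesIn (X □ zdGraph 2) S) : Set (Sym2 (W × Site 2))) ↑(edgesIn (X □ zdGraph 2) S)) (↑Qt : Set (W × Site 2)) (Finset.mem_coe.2 (hSQ ho))]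
    simp only [Finset.mem_coe]
  have h2 : (⋃ t ∈ (↑Ft : Set (W × Site 2)), openConnIn (↑Qt : Set (W × Site 2)) o t) ⊆ linkIn (↑Qt : Set (W × Site 2)) S Ft := by
    intro ω hω
    simp only [Set.mem_iUnion, exists_prop, Finset.mem_coe] at hω
    obtain ⟨t, ht, hot⟩ := hω
    exact mem_linkIn_iff.2 ⟨o, ho, t, ht, hot⟩
  calc (prodBernoulli (routeW X Wt Qt S)).real (⋃ t ∈ Ft, openConn o t)
      = (prodBernoulli (pinW Wt (↑(edgesIn (X □ zdGraph 2) S) : Set (Sym2 (W × Site 2))) ↑(edgesIn (X □ zdGraph 2) S))).real (⋃ t ∈ (↑Ft : Set (W × Site 2)), openConnIn (↑Qt : Set (W × Site 2)) o t) := h1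
    _ ≤ (prodBernoulli (pinW Wt (↑(edgesIn (X □ zdGraph 2) S) : Set (Sym2 (W × Site 2))) ↑(edgesIn (X □ zdGraph 2) S))).real (linkIn (↑Qt : Set (W × Site 2)) S Ft) := measureReal_mono h2 (measure_ne_top _ _)
    _ = (prodBernoulli Wt).real (linkIn (↑Qt : Set (W × Site 2)) S Ft) :=
        (real_linkIn_eq_pinW_source Wt Qt hSF (coe_edgesIn_subset_wireSet X S) _).symm

/-! ## §4 The first hop from the wired prism (pointwise seed bound) -/

omit [DecidableEq W] [X.LocallyFinite] in
/-- Monotonicity of the real-valued measure along an a.s. inclusion. [folklore] -/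
private theorem measureReal_mono_ae'' {α : Type*} [MeasurableSpace α] {μ : Measure α} [IsFiniteMeasure μ] {s t : Set α}
    (h : ∀ᵐ x ∂μ, x ∈ s → x ∈ t) : μ.real s ≤ μ.real t := by
  rw [measureReal_def, measureReal_def]
  exact ENNReal.toReal_mono (measure_ne_top _ _) (measure_mono_ae h)

/-- **The first hop from a wired prism, product form, with the seed bound only at the representative** (`msel (γ c) ≤ ℓ`): if `W'` gives
weight `1` to the edges inside `S = frameSeq γ v (γ c) (msel (γ c))` and weight `≥ q` to the edges of `frameSeq γ v (γ c) ℓ`, the link input at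
scale `ℓ` at the running parameter gives `1 - δ² < P_{W'}(⋃_{t ∈ B(c, ψ ℓ) × (v + F)} (c, v) ↔ t)` for every quarter-face `F`.
[cite: KozmaNitzan2024, §4 Lemma 9 (p. 16), Lemma 11 (p. 22)] -/
theorem wired_prism_hsrc_of_le [Countable W] {p₀ : unitInterval} (hT : TubeSubcritical X p₀) (V₀ : Finset W) {q : unitInterval} {δ : ℝ}
    {msel : W → ℕ} {ℓ : ℕ}
    (hlink : ∀ τ ∈ V₀, ∀ g : GM.HOct 2, 1 - δ ^ 2 < (bondPercolation (X □ zdGraph 2) q).real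
      (linkIn (↑(ufatSeq X hT V₀ τ ℓ)) (ufatSeq X hT V₀ τ (msel τ)) (ballFin X τ (ufatRadius X hT V₀ ℓ) ×ˢ GM.piece g ℓ)))
    {W' : Sym2 (W × Site 2) → unitInterval} {c : W} (γ : X ≃g X) (hγ : γ c ∈ V₀) (hmℓ : msel (γ c) ≤ ℓ) (v : Site 2)
    (hge : ∀ u ∈ frameSeq X hT V₀ γ v (γ c) ℓ, ∀ u' ∈ frameSeq X hT V₀ γ v (γ c) ℓ, (X □ zdGraph 2).Adj u u' → q ≤ W' s(u, u'))
    (hone : ∀ u ∈ frameSeq X hT V₀ γ v (γ c) (msel (γ c)), ∀ u' ∈ frameSeq X hT V₀ γ v (γ c) (msel (γ c)),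
      (X □ zdGraph 2).Adj u u' → W' s(u, u') = 1)
    (a : Fin 2) (τ' : Fin 2 → ℤˣ) :
    1 - δ ^ 2 < (prodBernoulli W').real
      (⋃ t ∈ ballFin X c (ufatRadius X hT V₀ ℓ) ×ˢ (orthantFace a τ' ℓ).image (fun t => t + v), openConn ((c, v) : W × Site 2) t) := by
  rw [← fatFace_image_eq X hT V₀ γ c v ℓ a τ']
  set S := frameSeq X hT V₀ γ v (γ c) (msel (γ c)) with hSdef
  have h1 := link_frameSeq_center_of_leQ X hT V₀ hlink (Wt := W') γ hγ v hge a τ'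
  -- the wired prism's edges are a.s. open
  have hae : ∀ᵐ ω ∂prodBernoulli W', ∀ u u', u ∈ (↑S : Set (W × Site 2)) → u' ∈ (↑S : Set (W × Site 2)) →
      (X □ zdGraph 2).Adj u u' → s(u, u') ∈ ω := by
    have key : ∀ e' : Sym2 (W × Site 2), ∀ᵐ ω ∂prodBernoulli W', W' e' = 1 → e' ∈ ω := by
      intro e'
      by_cases he : W' e' = 1
      · filter_upwards [prodBernoulli_ae_mem_of_eq_one _ he] with ω hω _ using hω
      · exact Filter.Eventually.of_forall fun ω h' => absurd h' he
    rw [← ae_all_iff] at key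
    filter_upwards [key] with ω hω u u' hu hu' hadj
    exact hω _ (hone u (Finset.mem_coe.1 hu) u' (Finset.mem_coe.1 hu') hadj)
  refine lt_of_lt_of_le h1 (measureReal_mono_ae'' ?_)
  filter_upwards [hae] with ω hopen hω
  have hSU : (↑S : Set (W × Site 2)) ⊆ ↑(frameSeq X hT V₀ γ v (γ c) ℓ) := Finset.coe_subset.2 (frameSeq_mono X hT V₀ γ v (γ c) hmℓ)
  have h2 := linkIn_subset_biUnion_openConnIn_of_wired (G := X □ zdGraph 2) hSU (o := (c, v))
    (fun s hs => by simpa [γ.symm_apply_apply] using pathIn_frameSeq X hT V₀ γ v (γ c) (msel (γ c)) hs) hopen hω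
  simp only [Set.mem_iUnion, exists_prop] at h2 ⊢
  obtain ⟨t, ht, h3⟩ := h2
  exact ⟨t, ht, openConnIn_subset_openConn _ _ _ h3⟩

end BoxProdZ2

end Transplant

end Summit.CriticalPhenomena.PercolationContinuityZ3.Theorems

end
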